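import Mathlib
import Literature.RepresentationTheory.FiniteGroups.CharacterDegrees
import Summits.MatrixMultiplication.MatrixMultiplication.Theorems.SubgroupIdentityDesigns.Negative.TorusCube

/-!
# The top level `k ≥ m` tests nothing and prices everything (negative lemma for the crux
`SubgroupIdentityDesigns`, stmt-MatrixMultiplication-14079)

The crux quantifies over a Fourier LEVEL `k`: tests `f(g) = Σ_{rk M ≤ k} c_M ψ(tr(M g))` on
`GL_m(𝔽_p)` and the graded budget `Σ_{χ ∈ Irr(GL_m(𝔽_p)) ∩ F_k} χ(1)^{2+ε}`.  This file records that the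
level is load-bearing ONLY for `k < m`:

* `sum_psi_trace_mul` — orthogonality on `M_m(𝔽_p)`: `Σ_M ψ(tr(M D)) = p^{m·m} [D = 0]`.
* `exists_level_of_le` — **Fourier inversion**: for `m ≤ k` EVERY function on `GL_m(𝔽_p)` has level
  `k` (all matrices have rank `≤ m ≤ k`).
* `idTest_clause_of_le` — hence for `m ≤ k` the identity-test clause of the crux holds for EVERY triple
  of subgroups (take `f = δ_1`; no TPP needed), and
* `irrChars_inter_level_of_le` — the budget set `Irr ∩ F_k` is ALL of `Irr(GL_m(𝔽_p))`: the graded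
  budget is the full `Σ_{χ ∈ Irr} χ(1)^{2+ε}`.

So the sub-family `k ≥ m` of `SubgroupIdentityDesigns` is exactly the classical (ungraded) question
"three TPP SUBGROUPS of some `GL_m(𝔽_p)` beat `Σ_{χ} χ(1)^{2+ε}` for every `ε`", to which the tree's
subgroup barriers apply verbatim (`SubgroupTPP.normalizer_barrier`, `SubgroupTPP.center_barrier`:
`V² |Z(G)| ≤ |G|³`, BCGPU 2023 Thm 3.6 / Cor 3.8) together with the quasirandom barrier at FULL budget
(`Literature.Barriers.MatrixMultiplication.QuasirandomBarrier`); a witness of the crux proper has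
`k < m`.  Sorry-free; standard axioms.
-/

set_option linter.dupNamespace false

noncomputable section

open scoped BigOperators Classical

namespace Summit.MatrixMultiplication.MatrixMultiplication.Theorems.SubgroupIdentityDesigns.Negative

variable {p m : ℕ} [Fact p.Prime]

/-- **Orthogonality on `M_m(𝔽_p)`**: `Σ_{M} ψ(tr(M D)) = p^{m·m} · [D = 0]`. [folklore] -/
theorem sum_psi_trace_mul (D : CMat p m) :
    ∑ M : CMat p m, ZMod.stdAddChar (Matrix.trace (M * D)) =
      if D = 0 then ((p : ℂ) ^ (m * m)) else 0 := by
  classical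
  have htr : ∀ M : CMat p m, ZMod.stdAddChar (Matrix.trace (M * D)) =
      ∏ i, ∏ j, ZMod.stdAddChar (D j i * M i j) := by
    intro M
    simp only [Matrix.trace, Matrix.diag_apply, Matrix.mul_apply]
    rw [stdAddChar_map_sum]
    refine Finset.prod_congr rfl fun i _ => ?_
    rw [stdAddChar_map_sum]
    exact Finset.prod_congr rfl fun j _ => by rw [mul_comm]
  simp_rw [htr]
  have key : ∑ M : CMat p m, ∏ i, ∏ j, ZMod.stdAddChar (D j i * M i j) =
      ∏ i : Fin m, ∏ j : Fin m, ∑ x : ZMod p, ZMod.stdAddChar (D j i * x) := by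
    calc ∑ M : CMat p m, ∏ i, ∏ j, ZMod.stdAddChar (D j i * M i j)
        = ∑ f : Fin m → Fin m → ZMod p, ∏ i, ∏ j, ZMod.stdAddChar (D j i * f i j) :=
          (Fintype.sum_equiv Matrix.of _ _ (fun f => rfl)).symm
      _ = ∏ i : Fin m, ∑ r : Fin m → ZMod p, ∏ j, ZMod.stdAddChar (D j i * r j) :=
          (Fintype.prod_sum (fun (i : Fin m) (r : Fin m → ZMod p) =>
            ∏ j, ZMod.stdAddChar (D j i * r j))).symm
      _ = ∏ i : Fin m, ∏ j : Fin m, ∑ x : ZMod p, ZMod.stdAddChar (D j i * x) :=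
          Finset.prod_congr rfl fun i _ =>
            (Fintype.prod_sum (fun (j : Fin m) (x : ZMod p) => ZMod.stdAddChar (D j i * x))).symm
  rw [key]
  simp_rw [sum_psi_mul]
  by_cases hD : D = 0
  · subst hD
    simp only [Matrix.zero_apply, if_true]
    simp only [Finset.prod_const, Finset.card_univ, Fintype.card_fin]
    rw [← pow_mul]
  · rw [if_neg hD]
    obtain ⟨j, i, hji⟩ : ∃ j i, D j i ≠ 0 := by
      by_contra hne
      push Not at hne
      exact hD (Matrix.ext fun j i => hne j i)
    refine Finset.prod_eq_zero (Finset.mem_univ i) (Finset.prod_eq_zero (Finset.mem_univ j) ?_)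
    rw [if_neg hji]

/-- **Fourier inversion at the top level.**  For `m ≤ k` every `f : GL_m(𝔽_p) → ℂ` is a level-`k`
Fourier function (in the crux's literal form). -/
theorem exists_level_of_le {k : ℕ} (hk : m ≤ k)
    (f : Matrix.GeneralLinearGroup (Fin m) (ZMod p) → ℂ) :
    ∃ c : Matrix (Fin m) (Fin m) (ZMod p) → ℂ, (∀ M, k < M.rank → c M = 0) ∧
      ∀ g : Matrix.GeneralLinearGroup (Fin m) (ZMod p), f g =
        ∑ M : Matrix (Fin m) (Fin m) (ZMod p),
          c M * ZMod.stdAddChar (Matrix.trace (M * (g : Matrix (Fin m) (Fin m) (ZMod p)))) := by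
  classical
  have hN0 : ((p : ℂ) ^ (m * m)) ≠ 0 := pow_ne_zero _ (Nat.cast_ne_zero.mpr (NeZero.ne p))
  refine ⟨fun M => ((p : ℂ) ^ (m * m))⁻¹ *
      ∑ h : Matrix.GeneralLinearGroup (Fin m) (ZMod p),
        f h * ZMod.stdAddChar (Matrix.trace (M * (-(h : CMat p m)))), ?_, fun g => ?_⟩
  · intro M hM
    exfalso
    have := Matrix.rank_le_width M
    omega
  · have hexp : ∀ M : CMat p m,
        (((p : ℂ) ^ (m * m))⁻¹ *
            ∑ h : Matrix.GeneralLinearGroup (Fin m) (ZMod p),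
              f h * ZMod.stdAddChar (Matrix.trace (M * (-(h : CMat p m))))) *
          ZMod.stdAddChar (Matrix.trace (M * (g : CMat p m))) =
        ((p : ℂ) ^ (m * m))⁻¹ *
          ∑ h : Matrix.GeneralLinearGroup (Fin m) (ZMod p),
            f h * ZMod.stdAddChar (Matrix.trace (M * ((g : CMat p m) - (h : CMat p m)))) := by
      intro M
      rw [mul_assoc, Finset.sum_mul]
      congr 1
      refine Finset.sum_congr rfl fun h _ => ?_
      rw [mul_assoc, ← AddChar.map_add_eq_mul, ← Matrix.trace_add, ← Matrix.mul_add,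
        neg_add_eq_sub]
    simp_rw [hexp]
    rw [← Finset.mul_sum, Finset.sum_comm]
    simp_rw [← Finset.mul_sum, sum_psi_trace_mul, sub_eq_zero]
    have hval : ∀ h : Matrix.GeneralLinearGroup (Fin m) (ZMod p),
        f h * (if ((g : CMat p m) = (h : CMat p m)) then ((p : ℂ) ^ (m * m)) else 0) =
        if g = h then f g * ((p : ℂ) ^ (m * m)) else 0 := by
      intro h
      by_cases hgh : g = h
      · subst hgh; rw [if_pos rfl, if_pos rfl]
      · rw [if_neg (fun e => hgh (Units.ext e)), if_neg hgh, mul_zero]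
    simp_rw [hval]
    rw [Finset.sum_ite_eq, if_pos (Finset.mem_univ _), ← mul_assoc, mul_comm (((p : ℂ) ^ (m * m))⁻¹),
      mul_assoc, inv_mul_cancel₀ hN0, mul_one]

/-- **At the top level the identity-test clause of the crux holds for EVERY subgroup triple** (take
`f = δ_1`; no triple product property is needed): for `m ≤ k` the hypothesis "ONE rank-`≤ k` test
isolates `1` on `H₁H₂H₃`" is vacuous. -/
theorem idTest_clause_of_le {k : ℕ} (hk : m ≤ k)
    (H₁ H₂ H₃ : Subgroup (Matrix.GeneralLinearGroup (Fin m) (ZMod p))) :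
    ∃ c : Matrix (Fin m) (Fin m) (ZMod p) → ℂ, (∀ M, k < M.rank → c M = 0) ∧
      (∑ M : Matrix (Fin m) (Fin m) (ZMod p), c M * ZMod.stdAddChar (Matrix.trace
        (M * ((1 : Matrix.GeneralLinearGroup (Fin m) (ZMod p)) : Matrix (Fin m) (Fin m) (ZMod p))))) = 1 ∧
      ∀ a ∈ H₁, ∀ b ∈ H₂, ∀ g ∈ H₃, a * b * g ≠ 1 →
        (∑ M : Matrix (Fin m) (Fin m) (ZMod p), c M * ZMod.stdAddChar (Matrix.trace
          (M * ((a * b * g : Matrix.GeneralLinearGroup (Fin m) (ZMod p)) :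
            Matrix (Fin m) (Fin m) (ZMod p))))) = 0 := by
  classical
  obtain ⟨c, hc, hf⟩ := exists_level_of_le hk
    (fun g : Matrix.GeneralLinearGroup (Fin m) (ZMod p) => if g = 1 then (1 : ℂ) else 0)
  refine ⟨c, hc, ?_, fun a _ b _ g _ hne => ?_⟩
  · rw [← hf 1]; exact if_pos rfl
  · rw [← hf (a * b * g)]; exact if_neg hne

/-- **At the top level the budget set is all of `Irr(GL_m(𝔽_p))`**: for `m ≤ k`,
`Irr ∩ F_k = Irr`, so the graded budget `Σᶠ_{χ ∈ Irr ∩ F_k} χ(1)^s` is the full `Σᶠ_{χ ∈ Irr} χ(1)^s`. -/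
theorem irrChars_inter_level_of_le {k : ℕ} (hk : m ≤ k) :
    Literature.RepresentationTheory.FiniteGroups.irrChars (Matrix.GeneralLinearGroup (Fin m) (ZMod p)) ∩
      {f | ∃ c : Matrix (Fin m) (Fin m) (ZMod p) → ℂ, (∀ M, k < M.rank → c M = 0) ∧
        ∀ g : Matrix.GeneralLinearGroup (Fin m) (ZMod p), f g =
          ∑ M : Matrix (Fin m) (Fin m) (ZMod p),
            c M * ZMod.stdAddChar (Matrix.trace (M * (g : Matrix (Fin m) (Fin m) (ZMod p))))} =
    Literature.RepresentationTheory.FiniteGroups.irrChars (Matrix.GeneralLinearGroup (Fin m) (ZMod p)) := by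
  refine Set.inter_eq_left.2 fun f _ => ?_
  exact exists_level_of_le hk f

end Summit.MatrixMultiplication.MatrixMultiplication.Theorems.SubgroupIdentityDesigns.Negative

end
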